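import Summits.ValiantsHypothesis.ValiantsHypothesis.Theorems.NewtonTauWeak.Negative.Zonogon

/-!
# Route NewtonUnitEquations — crux `NewtonTauWeak` (stmt-ValiantsHypothesis-5904), line `aligned-peeling`: objects

Definitions file for the crux-strategist line `Cruxes/NewtonTauWeak/Lines/aligned_peeling.lean` (registered
alongside the line of record; stubs `stub_alignedPeeling` [open, hardest] and `stub_peelInduction` [provable now —
proved as crux-workfile evidence `Lines/aligned_peeling_peelInduction.lean`, landed in the companion theorem file]).
The line states its stubs over three objects which it defines locally; this file puts them VERBATIM (same names)
into an importable module, together with the budget recursion of the peel induction: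

* `SpsBound a b` — the crux's bound with FIXED constants: `vert(Σ_{i<k} Π_{j<m} f_ij) ≤ 2^{a m}(k t+2)^b` for
  `t`-sparse bivariate `f_ij` (`NewtonTauWeak` is `∃ a b, SpsBound a b`);
* `AlignedBound g V` — every ALIGNED combination `Σ_i d_i X^{a_i} Π_j g_ij` has `≤ V` hull vertices;
* `AlignedPeeling C c` — the one-step statement: `vert(Σ_i p_i Π_j g_ij) ≤ C·V + (k t+2)^c` whenever `V` bounds
  every aligned combination (the line's load-bearing OPEN stub asserts `∃ C c, AlignedPeeling C c`);
* `budget C c k t ℓ` — `B 0 = k`, `B (ℓ+1) = C · B ℓ + (k t+2)^c`.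

`vert` is the tree's hull-vertex count `Theorems.NewtonTauWeak.Negative.vert` (Zonogon file). No statement is asserted
here. Honest framing: vocabulary only; the crux `NewtonTauWeak` is OPEN and nothing here bears on `VP ≠ VNP`.
-/

set_option linter.dupNamespace false

namespace Summit.ValiantsHypothesis.ValiantsHypothesis.Theorems.NewtonTauWeak.AlignedPeeling

open scoped BigOperators
open MvPolynomial
open Summit.ValiantsHypothesis.ValiantsHypothesis.Theorems.NewtonTauWeak.Negative (vert)

noncomputable section

/-- The crux's bound with FIXED constants `(a, b)`: `vert(Σ_{i<k} Π_{j<m} f_ij) ≤ 2^{a m}(k t+2)^b` for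
`t`-sparse `f_ij ∈ ℂ[X,Y]` (`NewtonTauWeak` is `∃ a b, SpsBound a b`). [folklore] -/
def SpsBound (a b : ℕ) : Prop :=
  ∀ (k m t : ℕ) (f : Fin k → Fin m → MvPolynomial (Fin 2) ℂ),
    (∀ i j, (f i j).support.card ≤ t) → vert (∑ i, ∏ j, f i j) ≤ 2 ^ (a * m) * (k * t + 2) ^ b

/-- Aligned-combination bound: every `Σ_i d_i X^{a_i} Π_j g_ij` (one monomial shift and one scalar per component)
has at most `V` hull vertices. [folklore] -/
def AlignedBound {k ℓ : ℕ} (g : Fin k → Fin ℓ → MvPolynomial (Fin 2) ℂ) (V : ℕ) : Prop :=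
  ∀ (a : Fin k → (Fin 2 →₀ ℕ)) (d : Fin k → ℂ), vert (∑ i, monomial (a i) (d i) * ∏ j, g i j) ≤ V

/-- Aligned peeling with constants `(C, c)` (the line's one-step statement; its existential closure is the line's
OPEN load-bearing stub): for `t`-sparse factors `g_ij` and multipliers `p_i`, a bound `V` on every aligned
combination gives `vert(Σ_i p_i Π_j g_ij) ≤ C·V + (k t + 2)^c`. [folklore] -/
def AlignedPeeling (C c : ℕ) : Prop :=
  ∀ (k ℓ t V : ℕ) (g : Fin k → Fin ℓ → MvPolynomial (Fin 2) ℂ) (p : Fin k → MvPolynomial (Fin 2) ℂ),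
    (∀ i j, (g i j).support.card ≤ t) → (∀ i, (p i).support.card ≤ t) → AlignedBound g V →
      vert (∑ i, p i * ∏ j, g i j) ≤ C * V + (k * t + 2) ^ c

/-- The budget recursion of the peel induction: `B 0 = k`, `B (ℓ+1) = C · B ℓ + (k t + 2)^c`. [folklore] -/
def budget (C c k t : ℕ) : ℕ → ℕ
  | 0 => k
  | ℓ + 1 => C * budget C c k t ℓ + (k * t + 2) ^ c

end

end Summit.ValiantsHypothesis.ValiantsHypothesis.Theorems.NewtonTauWeak.AlignedPeeling
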